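import Summits.AtomisticToContinuum.FouriersLaw.Theses.OddSectorIrreversibility
import Summits.AtomisticToContinuum.FouriersLaw.Theses.SpatialCentreManifold
import Summits.AtomisticToContinuum.FouriersLaw.Theses.ProfileLadder
import Summits.AtomisticToContinuum.FouriersLaw.Theses.JunctionLocality
import Summits.AtomisticToContinuum.FouriersLaw.Theorems.PhononMeanFreePathBoundaryKubo
import Summits.AtomisticToContinuum.FouriersLaw.Theorems.TransferKernelPositivityContactIdentity

/-!
# Stub S3 `layerBounded` of line `comonotone-local-resistance` (crux stmt-AtomisticToContinuum-9141):
# what it hinges on — two by-name bridges and the fixed-`N` dictionary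

Support file (`--supports stmt-AtomisticToContinuum-9141`) for the stub `stub_layerBounded` of the line
`comonotone-local-resistance` of the crux `OddSectorIrreversibility.BoundedResponseConverges`.

THE STUB (S3, "every fixed-depth bond is a finite passive resistor"). Frame: `pinnedChain ω₂ lam β γ`
(all `> 0`), weak-NESS uniqueness, a steady family `μ`, `T > 0`. With `θ` the kinetic-temperature response
profile of the `N`-chain (`θ i = lim_{δ→0} (μ_{N,T+δ/2,T-δ/2}(p_i²) − μ_{N,T,T}(p_i²))/δ`) and `d = D_N` the
response of the total current, the LOCAL RESISTANCE of bond `(j, j+1)` is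
`r_j^{(N)} := (θ j − θ (j+1)) · ((N−1)/d)`; S3 asks, at every FIXED depth `j`, for a bound `|r_j^{(N)}| ≤ B_j`
UNIFORM in the length `N ≥ N₀(j)`.

VERDICT OF THIS FILE. S3 is a genuine `N`-uniform estimate on the linear-response temperature profile near
the contact ("the kinetic-temperature drop across bond `j` is `O(current)`"), for which no engine exists in
print (Bonetto–Lebowitz–Rey-Bellet 2000 §6.3); the exact fixed-`N` stationarity identities for degree-2
observables only trade the drop `⟨p_j²⟩ − ⟨p_{j+1}²⟩` for position–force correlations whose response is
equally uncontrolled. What IS proved here: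

* `stub_layerBounded_of_localFourierLaw` — S3 (verbatim, even with `B` independent of `j` and `N₀ = 0`)
  follows from the single route item `SpatialCentreManifold.LocalFourierLaw` (stmt-AtomisticToContinuum-13406:
  `|τ(i+1) − τ(i) + r·ι| ≤ |ι|(a_i + a_{N−2−i})`, `a` summable): `|r_j| ≤ r + 2 Σ a`.
* `stub_layerBounded_of_kapitzaBound_of_conductanceLowerBound` — S3 (verbatim) follows from
  `ProfileLadder.KapitzaBound` (stmt-12676: `|θ(i) − 1/2| ≤ C_b(|d|+1)/(N−1)` for `i ≤ b`) together with
  `JunctionLocality.ConductanceLowerBound` (stmt-11749: `D_N ≥ c > 0` eventually): `|r_j| ≤ 2C_{j+1}(1 + 1/c)`.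
  (Kapitza alone gives `|r_j| ≤ 2C(1 + 1/D_N)`, uniform exactly when the conductance does not degenerate.)
* `localResistance_eq_div_contactDrop`, `layerBound_iff_drop_le_contactDrop` — the fixed-`N` dictionary
  (from the landed `ContactIdentity`, stmt-12015): `r_j^{(N)} = (θ j − θ (j+1)) / (γ (1/2 − θ 0))`, so S3 is
  EQUIVALENT to the pure profile-shape statement "no fixed-depth bond drops more than `B_j γ` times the
  contact (Kapitza) jump `1/2 − θ 0`", `|θ_N(j) − θ_N(j+1)| ≤ B_j γ (1/2 − θ_N(0))` for `N ≥ N₀(j)`.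
* two pieces of limit algebra used above (`eq_of_tendsto_sub_div`, `exists_responseSeq`).

No definitions, no named facts, standard axioms. The neighbouring stubs S1/S2 are not touched.
-/

noncomputable section

namespace Summit.AtomisticToContinuum.FouriersLaw.Cruxes.BoundedResponseConverges.ComonotoneLocalResistance.Stubs

open MeasureTheory Filter Topology
open Literature.MathematicalPhysics.KineticTheory.HeatConduction
open Summit.AtomisticToContinuum.FouriersLaw.Theorems.BoundaryKubo.Negative.LoadBearing (kuboValue)

/-! ### Limit algebra -/

/-- **Two difference quotients of one function with two base points.** If `(m δ − c₁)/δ → L₁` and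
`(m δ − c₂)/δ → L₂` as `δ → 0`, `δ ≠ 0`, then `c₁ = c₂` and `L₁ = L₂`: the difference `(c₂ − c₁)/δ` has a
finite limit only if `c₂ = c₁`. (Used to identify the profile `τ` of `SpatialCentreManifold.LocalFourierLaw`,
based at `T`, with the stub's `θ`, based at `μ_{N,T,T}(p_i²)`; equipartition `μ_{N,T,T}(p_i²) = T` drops out
as a by-product.) [folklore] -/
theorem eq_of_tendsto_sub_div {m : ℝ → ℝ} {c₁ c₂ L₁ L₂ : ℝ}
    (h₁ : Tendsto (fun δ : ℝ => (m δ - c₁) / δ) (𝓝[≠] 0) (𝓝 L₁))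
    (h₂ : Tendsto (fun δ : ℝ => (m δ - c₂) / δ) (𝓝[≠] 0) (𝓝 L₂)) : c₁ = c₂ ∧ L₁ = L₂ := by
  have hF : Tendsto (fun δ : ℝ => (m δ - c₁) / δ - (m δ - c₂) / δ) (𝓝[≠] 0) (𝓝 (L₁ - L₂)) :=
    h₁.sub h₂
  have hc : ∀ᶠ δ in 𝓝[≠] (0 : ℝ), ((m δ - c₁) / δ - (m δ - c₂) / δ) * δ = c₂ - c₁ := by
    filter_upwards [self_mem_nhdsWithin] with δ hδ
    have hδ' : δ ≠ 0 := hδ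
    field_simp
    ring
  obtain ⟨h0, hL⟩ :=
    Theorems.ContactIdentity.eq_zero_of_tendsto_of_mul_eq hF hc
  constructor
  · linarith
  · linarith

/-- **A full sequence of response coefficients exists** along any steady family (under weak-NESS
uniqueness, `T > 0`): `D_{M+1} = kuboValue M` by the landed `BoundaryKubo` (`boundaryKubo_proof`), and
`D_0 = 0` (the empty chain carries no current). Needed to feed `JunctionLocality.ConductanceLowerBound`,
which quantifies over response SEQUENCES. [folklore] -/
theorem exists_responseSeq {ω₂ lam β γ : ℝ} (hω : 0 < ω₂) (hl : 0 < lam) (hβ : 0 < β) (hγ : 0 < γ)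
    (hU : ∀ (N : ℕ) (T_L T_R : ℝ), 0 < T_L → 0 < T_R → ∀ μ' ν' : Measure (PhaseSpace N),
      (pinnedChain ω₂ lam β γ).IsSteadyState N T_L T_R μ' →
        (pinnedChain ω₂ lam β γ).IsSteadyState N T_L T_R ν' → μ' = ν')
    {μ : (M : ℕ) → ℝ → ℝ → Measure (PhaseSpace M)}
    (hμ : ∀ (N : ℕ) (T_L T_R : ℝ), 0 < T_L → 0 < T_R →
      (pinnedChain ω₂ lam β γ).IsSteadyState N T_L T_R (μ N T_L T_R))
    {T : ℝ} (hT : 0 < T) :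
    ∃ D : ℕ → ℝ, ∀ N : ℕ, Tendsto (fun δ : ℝ =>
      (pinnedChain ω₂ lam β γ).totalCurrent (μ N (T + δ / 2) (T - δ / 2)) / δ) (𝓝[≠] 0) (𝓝 (D N)) := by
  refine ⟨fun N => if N = 0 then 0 else kuboValue ω₂ lam β γ T (N - 1), fun N => ?_⟩
  cases N with
  | zero =>
    simp only [if_true, OscillatorChain.totalCurrent_zero, zero_div]
    exact tendsto_const_nhds
  | succ M =>
    simp only [Nat.succ_ne_zero, if_false, Nat.add_sub_cancel]
    exact (Theorems.PhononMeanFreePathBoundaryKubo.boundaryKubo_proof ω₂ lam β γ hω hl hβ hγ hU μ hμ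
      T hT M).2

/-! ### Bridge 1: S3 from `SpatialCentreManifold.LocalFourierLaw` (stmt-AtomisticToContinuum-13406) -/

/-- **S3 ⇐ local Fourier law with summable contact layers.** If `SpatialCentreManifold.LocalFourierLaw`
holds (`|τ(i+1) − τ(i) + r ι_N| ≤ |ι_N| (a_i + a_{N−2−i})` on every bond, `a ≥ 0` summable, `ι_N = D_N/(N−1)`),
then the stub `stub_layerBounded` holds VERBATIM, with the `j`-independent bound `B = r + 2 Σ_n a_n` and
`N₀ = 0`: the drop across bond `j` is `|θ j − θ (j+1)| ≤ ι_N (r + a_j + a_{N−2−j})` and the local resistance is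
that drop divided by `ι_N`. The profile `τ` of the item (quotients based at `T`) is identified with the stub's
`θ` (quotients based at the equilibrium value) by `eq_of_tendsto_sub_div`. [folklore] -/
theorem stub_layerBounded_of_localFourierLaw :
    Summit.AtomisticToContinuum.FouriersLaw.Theses.SpatialCentreManifold.LocalFourierLaw →
    ∀ ω₂ lam β γ : ℝ, 0 < ω₂ → 0 < lam → 0 < β → 0 < γ →
    (∀ (N : ℕ) (T_L T_R : ℝ), 0 < T_L → 0 < T_R →
      ∀ μ ν : MeasureTheory.Measure (Literature.MathematicalPhysics.KineticTheory.HeatConduction.PhaseSpace N),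
      (Literature.MathematicalPhysics.KineticTheory.HeatConduction.pinnedChain ω₂ lam β γ).IsSteadyState N T_L T_R μ →
      (Literature.MathematicalPhysics.KineticTheory.HeatConduction.pinnedChain ω₂ lam β γ).IsSteadyState N T_L T_R ν →
      μ = ν) →
    ∀ μ : (N : ℕ) → ℝ → ℝ →
      MeasureTheory.Measure (Literature.MathematicalPhysics.KineticTheory.HeatConduction.PhaseSpace N),
      (∀ (N : ℕ) (T_L T_R : ℝ), 0 < T_L → 0 < T_R →
        (Literature.MathematicalPhysics.KineticTheory.HeatConduction.pinnedChain ω₂ lam β γ).IsSteadyState N T_L T_R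
          (μ N T_L T_R)) →
    ∀ T : ℝ, 0 < T → ∀ j : ℕ, ∃ B : ℝ, ∃ N₀ : ℕ,
        ∀ (N : ℕ) (θ : ℕ → ℝ) (d : ℝ), N₀ ≤ N → 2 * j + 2 ≤ N →
          (∀ i : Fin N, Filter.Tendsto (fun δ : ℝ =>
            ((∫ x, (x.2 i) ^ 2 ∂(μ N (T + δ / 2) (T - δ / 2))) - ∫ x, (x.2 i) ^ 2 ∂(μ N T T)) / δ)
            (nhdsWithin 0 {(0 : ℝ)}ᶜ) (nhds (θ i))) →
          Filter.Tendsto (fun δ : ℝ =>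
            (Literature.MathematicalPhysics.KineticTheory.HeatConduction.pinnedChain ω₂ lam β γ).totalCurrent
              (μ N (T + δ / 2) (T - δ / 2)) / δ) (nhdsWithin 0 {(0 : ℝ)}ᶜ) (nhds d) →
          0 < d →
          |(θ j - θ (j + 1)) * (((N : ℝ) - 1) / d)| ≤ B := by
  intro hLF ω₂ lam β γ hω hl hβ hγ hU μ hμ T hT j
  obtain ⟨r, hr, a, ha0, haS, hfam⟩ := hLF ω₂ lam β γ hω hl hβ hγ hU T hT
  have hfamμ := hfam μ hμ
  set A : ℝ := ∑' n, a n with hA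
  have haA : ∀ n, a n ≤ A := fun n => haS.le_tsum n (fun m _ => ha0 m)
  refine ⟨r + 2 * A, 0, ?_⟩
  intro N θ d _ hjN hθ hd hdpos
  obtain ⟨ι, τ, hι, hτ, hbond⟩ := hfamμ N
  have hN1 : (0 : ℝ) < (N : ℝ) - 1 := by
    have : (2 : ℝ) ≤ (N : ℝ) := by exact_mod_cast (show 2 ≤ N by omega)
    linarith
  -- `d = (N - 1) ι`, so `ι > 0`
  have hdι : d = ((N : ℝ) - 1) * ι := tendsto_nhds_unique hd hι
  have hιpos : 0 < ι := by
    by_contra h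
    have h' : ι ≤ 0 := not_lt.mp h
    have : ((N : ℝ) - 1) * ι ≤ 0 := mul_nonpos_iff.2 (Or.inl ⟨hN1.le, h'⟩)
    linarith
  -- `τ = θ` on `Fin N`
  have hτθ : ∀ i : Fin N, τ i = θ i := fun i => (eq_of_tendsto_sub_div (hτ i) (hθ i)).2
  -- the bond `(j, j+1)`
  have hjlt : j < N := by omega
  have hj1lt : j + 1 < N := by omega
  have hb := hbond ⟨j, hjlt⟩ ⟨j + 1, hj1lt⟩ rfl
  rw [hτθ, hτθ] at hb
  have hb' : |θ (j + 1) - θ j + r * ι| ≤ |ι| * (a j + a (N - 1 - (j + 1))) := hb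
  rw [abs_of_pos hιpos] at hb'
  have ha1 := haA j
  have ha2 := haA (N - 1 - (j + 1))
  have hsum : a j + a (N - 1 - (j + 1)) ≤ 2 * A := by linarith
  have hkey : |θ j - θ (j + 1)| ≤ ι * (r + 2 * A) := by
    have e : θ j - θ (j + 1) = -(θ (j + 1) - θ j + r * ι) + r * ι := by ring
    calc |θ j - θ (j + 1)| = |-(θ (j + 1) - θ j + r * ι) + r * ι| := by rw [← e]
      _ ≤ |-(θ (j + 1) - θ j + r * ι)| + |r * ι| := abs_add_le _ _
      _ = |θ (j + 1) - θ j + r * ι| + r * ι := by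
          rw [abs_neg, abs_of_pos (mul_pos hr hιpos)]
      _ ≤ ι * (a j + a (N - 1 - (j + 1))) + r * ι := by linarith
      _ ≤ ι * (2 * A) + r * ι := by nlinarith [hιpos.le]
      _ = ι * (r + 2 * A) := by ring
  have heq : (θ j - θ (j + 1)) * (((N : ℝ) - 1) / d) = (θ j - θ (j + 1)) / ι := by
    rw [hdι]
    field_simp
  rw [heq, abs_div, abs_of_pos hιpos, div_le_iff₀ hιpos]
  linarith [hkey]

/-! ### Bridge 2: S3 from `ProfileLadder.KapitzaBound` (stmt-12676) and
`JunctionLocality.ConductanceLowerBound` (stmt-11749) -/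

/-- **S3 ⇐ Kapitza bound + conductance floor.** If `ProfileLadder.KapitzaBound` holds (the first `b+1`
kinetic-temperature responses sit within `C_b(|d|+1)/(N−1)` of the bath response `1/2`) and
`JunctionLocality.ConductanceLowerBound` holds (`D_N ≥ c > 0` for `N ≥ N₁`), then the stub
`stub_layerBounded` holds VERBATIM with `B_j = 2|C_{j+1}|(1 + 1/c)`: the drop across bond `j ≤ b − 1` is at
most `2C_b(d+1)/(N−1)`, and times `(N−1)/d` this is `2C_b(1 + 1/d) ≤ 2C_b(1 + 1/c)`. Kapitza alone bounds
`|r_j^{(N)}|` by `2C(1 + 1/D_N)`, which is `N`-uniform exactly when the conductance does not degenerate —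
the floor is where `ConductanceLowerBound` enters. [folklore] -/
theorem stub_layerBounded_of_kapitzaBound_of_conductanceLowerBound :
    Summit.AtomisticToContinuum.FouriersLaw.Theses.ProfileLadder.KapitzaBound →
    Summit.AtomisticToContinuum.FouriersLaw.Theses.JunctionLocality.ConductanceLowerBound →
    ∀ ω₂ lam β γ : ℝ, 0 < ω₂ → 0 < lam → 0 < β → 0 < γ →
    (∀ (N : ℕ) (T_L T_R : ℝ), 0 < T_L → 0 < T_R →
      ∀ μ ν : MeasureTheory.Measure (Literature.MathematicalPhysics.KineticTheory.HeatConduction.PhaseSpace N),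
      (Literature.MathematicalPhysics.KineticTheory.HeatConduction.pinnedChain ω₂ lam β γ).IsSteadyState N T_L T_R μ →
      (Literature.MathematicalPhysics.KineticTheory.HeatConduction.pinnedChain ω₂ lam β γ).IsSteadyState N T_L T_R ν →
      μ = ν) →
    ∀ μ : (N : ℕ) → ℝ → ℝ →
      MeasureTheory.Measure (Literature.MathematicalPhysics.KineticTheory.HeatConduction.PhaseSpace N),
      (∀ (N : ℕ) (T_L T_R : ℝ), 0 < T_L → 0 < T_R →
        (Literature.MathematicalPhysics.KineticTheory.HeatConduction.pinnedChain ω₂ lam β γ).IsSteadyState N T_L T_R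
          (μ N T_L T_R)) →
    ∀ T : ℝ, 0 < T → ∀ j : ℕ, ∃ B : ℝ, ∃ N₀ : ℕ,
        ∀ (N : ℕ) (θ : ℕ → ℝ) (d : ℝ), N₀ ≤ N → 2 * j + 2 ≤ N →
          (∀ i : Fin N, Filter.Tendsto (fun δ : ℝ =>
            ((∫ x, (x.2 i) ^ 2 ∂(μ N (T + δ / 2) (T - δ / 2))) - ∫ x, (x.2 i) ^ 2 ∂(μ N T T)) / δ)
            (nhdsWithin 0 {(0 : ℝ)}ᶜ) (nhds (θ i))) →
          Filter.Tendsto (fun δ : ℝ =>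
            (Literature.MathematicalPhysics.KineticTheory.HeatConduction.pinnedChain ω₂ lam β γ).totalCurrent
              (μ N (T + δ / 2) (T - δ / 2)) / δ) (nhdsWithin 0 {(0 : ℝ)}ᶜ) (nhds d) →
          0 < d →
          |(θ j - θ (j + 1)) * (((N : ℝ) - 1) / d)| ≤ B := by
  intro hK hC ω₂ lam β γ hω hl hβ hγ hU μ hμ T hT j
  -- Kapitza at depth `b = j + 1`
  obtain ⟨C, N₀, hKap⟩ := hK ω₂ lam β γ hω hl hβ hγ hU μ hμ T hT (j + 1)
  -- the response sequence and its eventual floor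
  obtain ⟨D, hD⟩ := exists_responseSeq hω hl hβ hγ hU hμ hT
  obtain ⟨c, hc, N₁, hcD⟩ := hC ω₂ lam β γ hω hl hβ hγ hU μ hμ T hT D hD
  refine ⟨2 * |C| * (1 + 1 / c), max N₀ N₁, ?_⟩
  intro N θ d hN hjN hθ hd hdpos
  have hN0 : N₀ ≤ N := le_trans (le_max_left _ _) hN
  have hN1' : N₁ ≤ N := le_trans (le_max_right _ _) hN
  have hN1 : (0 : ℝ) < (N : ℝ) - 1 := by
    have : (2 : ℝ) ≤ (N : ℝ) := by exact_mod_cast (show 2 ≤ N by omega)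
    linarith
  -- `d = D N ≥ c`
  have hdD : d = D N := tendsto_nhds_unique hd (hD N)
  have hcd : c ≤ d := by rw [hdD]; exact hcD N hN1'
  -- Kapitza at the sites `j`, `j + 1`
  have hjlt : j < N := by omega
  have hj1lt : j + 1 < N := by omega
  have hKN := hKap N d (fun i => θ i) hN0 hd hθ
  have h1 : |θ j - 1 / 2| ≤ C * ((|d| + 1) / ((N : ℝ) - 1)) :=
    (hKN ⟨j, hjlt⟩).1 (show j ≤ j + 1 by omega)
  have h2 : |θ (j + 1) - 1 / 2| ≤ C * ((|d| + 1) / ((N : ℝ) - 1)) :=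
    (hKN ⟨j + 1, hj1lt⟩).1 (show j + 1 ≤ j + 1 from le_rfl)
  rw [abs_of_pos hdpos] at h1 h2
  have hq : 0 < (d + 1) / ((N : ℝ) - 1) := div_pos (by linarith) hN1
  have hCabs : C * ((d + 1) / ((N : ℝ) - 1)) ≤ |C| * ((d + 1) / ((N : ℝ) - 1)) :=
    mul_le_mul_of_nonneg_right (le_abs_self C) hq.le
  have hdrop : |θ j - θ (j + 1)| ≤ 2 * |C| * ((d + 1) / ((N : ℝ) - 1)) := by
    have e : θ j - θ (j + 1) = (θ j - 1 / 2) - (θ (j + 1) - 1 / 2) := by ring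
    calc |θ j - θ (j + 1)| = |(θ j - 1 / 2) - (θ (j + 1) - 1 / 2)| := by rw [← e]
      _ ≤ |θ j - 1 / 2| + |θ (j + 1) - 1 / 2| := abs_sub _ _
      _ ≤ 2 * |C| * ((d + 1) / ((N : ℝ) - 1)) := by linarith
  have hfrac : 0 < ((N : ℝ) - 1) / d := div_pos hN1 hdpos
  rw [abs_mul, abs_of_pos hfrac]
  have hCnn : 0 ≤ 2 * |C| := by positivity
  calc |θ j - θ (j + 1)| * (((N : ℝ) - 1) / d)
      ≤ 2 * |C| * ((d + 1) / ((N : ℝ) - 1)) * (((N : ℝ) - 1) / d) :=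
        mul_le_mul_of_nonneg_right hdrop hfrac.le
    _ = 2 * |C| * (1 + 1 / d) := by
        field_simp
    _ ≤ 2 * |C| * (1 + 1 / c) := by
        have h1d : 1 / d ≤ 1 / c := one_div_le_one_div_of_le hc hcd
        exact mul_le_mul_of_nonneg_left (by linarith) hCnn

/-! ### The fixed-`N` dictionary: local resistance = drop over the contact jump -/

/-- **Local resistance in profile-shape form (fixed `N`, exact).** Under the stub's frame, at `T > 0` and
`N ≥ 2`, for any profile `θ` whose site-`0` value is the contact response and any response coefficient `d`:
`(θ j − θ (j+1)) · ((N−1)/d) = (θ j − θ (j+1)) / (γ (1/2 − θ 0))` — by the landed contact identity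
`d = γ (N−1)(1/2 − θ 0)` (`TransferKernelPositivity.ContactIdentity`, stmt-12015). Hence S3 is equivalent
to the `d`-free shape statement `|θ_N(j) − θ_N(j+1)| ≤ B_j γ (1/2 − θ_N(0))` for `N ≥ N₀(j)`: no fixed-depth
bond drops more than `B_j γ` times the contact (Kapitza) jump. (Both sides are the junk `0` if `θ 0 = 1/2`,
which `PositiveConductance` excludes.) [cite: BonettoLebowitzReyBellet2000, §5.2 eqs. (25)–(27)] -/
theorem localResistance_eq_div_contactDrop {ω₂ lam β γ : ℝ} (hω : 0 < ω₂) (hl : 0 < lam) (hβ : 0 < β)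
    (hγ : 0 < γ)
    (hU : ∀ (N : ℕ) (T_L T_R : ℝ), 0 < T_L → 0 < T_R → ∀ μ' ν' : Measure (PhaseSpace N),
      (pinnedChain ω₂ lam β γ).IsSteadyState N T_L T_R μ' →
        (pinnedChain ω₂ lam β γ).IsSteadyState N T_L T_R ν' → μ' = ν')
    {μ : (M : ℕ) → ℝ → ℝ → Measure (PhaseSpace M)}
    (hμ : ∀ (N : ℕ) (T_L T_R : ℝ), 0 < T_L → 0 < T_R →
      (pinnedChain ω₂ lam β γ).IsSteadyState N T_L T_R (μ N T_L T_R))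
    {T : ℝ} (hT : 0 < T) {N : ℕ} (hN : 2 ≤ N) {θ : ℕ → ℝ} {d : ℝ}
    (hθ0 : Tendsto (fun δ : ℝ =>
      ((∫ x, (x.2 (⟨0, by omega⟩ : Fin N)) ^ 2 ∂(μ N (T + δ / 2) (T - δ / 2))) -
        ∫ x, (x.2 (⟨0, by omega⟩ : Fin N)) ^ 2 ∂(μ N T T)) / δ) (𝓝[≠] 0) (𝓝 (θ 0)))
    (hθ1 : Tendsto (fun δ : ℝ =>
      ((∫ x, (x.2 (⟨N - 1, by omega⟩ : Fin N)) ^ 2 ∂(μ N (T + δ / 2) (T - δ / 2))) -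
        ∫ x, (x.2 (⟨N - 1, by omega⟩ : Fin N)) ^ 2 ∂(μ N T T)) / δ) (𝓝[≠] 0) (𝓝 (θ (N - 1))))
    (hd : Tendsto (fun δ : ℝ =>
      (pinnedChain ω₂ lam β γ).totalCurrent (μ N (T + δ / 2) (T - δ / 2)) / δ) (𝓝[≠] 0) (𝓝 d))
    (j : ℕ) :
    (θ j - θ (j + 1)) * (((N : ℝ) - 1) / d) = (θ j - θ (j + 1)) / (γ * (1 / 2 - θ 0)) := by
  obtain ⟨h0, -⟩ := Theorems.transferKernelPositivity_contactIdentity_proof ω₂ lam β γ hω hl hβ hγ hU μ hμ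
    T hT N hN (θ 0) (θ (N - 1)) d hθ0 hθ1 hd
  have hN1 : ((N : ℝ) - 1) ≠ 0 := by
    have : (2 : ℝ) ≤ (N : ℝ) := by exact_mod_cast hN
    linarith
  by_cases hz : 1 / 2 - θ 0 = 0
  · have hd0 : d = 0 := by rw [h0, hz, mul_zero]
    rw [hd0, hz, div_zero, mul_zero, mul_zero, div_zero]
  · rw [h0, div_eq_mul_inv, div_eq_mul_inv]
    congr 1
    field_simp

/-- **S3 ⟺ "no fixed-depth bond drops more than `B γ` times the contact jump" (fixed `N`).** Under the
stub's frame, at `T > 0`, `N ≥ 2`, with `θ` pinned at the two contact sites, `d` the response coefficient and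
`d > 0`: the S3 inequality `|(θ j − θ (j+1)) · ((N−1)/d)| ≤ B` is equivalent to the `d`-free profile-shape
inequality `|θ j − θ (j+1)| ≤ B · γ (1/2 − θ 0)` (the contact jump `1/2 − θ 0 = d/(γ(N−1))` is positive).
[cite: BonettoLebowitzReyBellet2000, §5.2 eqs. (25)–(27)] -/
theorem layerBound_iff_drop_le_contactDrop {ω₂ lam β γ : ℝ} (hω : 0 < ω₂) (hl : 0 < lam) (hβ : 0 < β)
    (hγ : 0 < γ)
    (hU : ∀ (N : ℕ) (T_L T_R : ℝ), 0 < T_L → 0 < T_R → ∀ μ' ν' : Measure (PhaseSpace N),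
      (pinnedChain ω₂ lam β γ).IsSteadyState N T_L T_R μ' →
        (pinnedChain ω₂ lam β γ).IsSteadyState N T_L T_R ν' → μ' = ν')
    {μ : (M : ℕ) → ℝ → ℝ → Measure (PhaseSpace M)}
    (hμ : ∀ (N : ℕ) (T_L T_R : ℝ), 0 < T_L → 0 < T_R →
      (pinnedChain ω₂ lam β γ).IsSteadyState N T_L T_R (μ N T_L T_R))
    {T : ℝ} (hT : 0 < T) {N : ℕ} (hN : 2 ≤ N) {θ : ℕ → ℝ} {d : ℝ}
    (hθ0 : Tendsto (fun δ : ℝ =>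
      ((∫ x, (x.2 (⟨0, by omega⟩ : Fin N)) ^ 2 ∂(μ N (T + δ / 2) (T - δ / 2))) -
        ∫ x, (x.2 (⟨0, by omega⟩ : Fin N)) ^ 2 ∂(μ N T T)) / δ) (𝓝[≠] 0) (𝓝 (θ 0)))
    (hθ1 : Tendsto (fun δ : ℝ =>
      ((∫ x, (x.2 (⟨N - 1, by omega⟩ : Fin N)) ^ 2 ∂(μ N (T + δ / 2) (T - δ / 2))) -
        ∫ x, (x.2 (⟨N - 1, by omega⟩ : Fin N)) ^ 2 ∂(μ N T T)) / δ) (𝓝[≠] 0) (𝓝 (θ (N - 1))))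
    (hd : Tendsto (fun δ : ℝ =>
      (pinnedChain ω₂ lam β γ).totalCurrent (μ N (T + δ / 2) (T - δ / 2)) / δ) (𝓝[≠] 0) (𝓝 d))
    (hdpos : 0 < d) (j : ℕ) (B : ℝ) :
    |(θ j - θ (j + 1)) * (((N : ℝ) - 1) / d)| ≤ B ↔ |θ j - θ (j + 1)| ≤ B * (γ * (1 / 2 - θ 0)) := by
  obtain ⟨h0, -⟩ := Theorems.transferKernelPositivity_contactIdentity_proof ω₂ lam β γ hω hl hβ hγ hU μ hμ
    T hT N hN (θ 0) (θ (N - 1)) d hθ0 hθ1 hd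
  have hN1 : (0 : ℝ) < (N : ℝ) - 1 := by
    have : (2 : ℝ) ≤ (N : ℝ) := by exact_mod_cast hN
    linarith
  have hx : 0 < γ * (1 / 2 - θ 0) := by
    have h1 : 0 < γ * ((N : ℝ) - 1) * (1 / 2 - θ 0) := by rw [← h0]; exact hdpos
    have h2 : 0 < 1 / 2 - θ 0 := by
      by_contra h
      have h' : 1 / 2 - θ 0 ≤ 0 := not_lt.mp h
      have : γ * ((N : ℝ) - 1) * (1 / 2 - θ 0) ≤ 0 :=
        mul_nonpos_iff.2 (Or.inl ⟨(mul_pos hγ hN1).le, h'⟩)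
      linarith
    exact mul_pos hγ h2
  rw [localResistance_eq_div_contactDrop hω hl hβ hγ hU hμ hT hN hθ0 hθ1 hd j, abs_div, abs_of_pos hx,
    div_le_iff₀ hx]

end Summit.AtomisticToContinuum.FouriersLaw.Cruxes.BoundedResponseConverges.ComonotoneLocalResistance.Stubs

end
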